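import Literature.AlgebraicGeometry.HodgeTheory.CMHodgeGroupNoTwist
import Literature.AlgebraicGeometry.HodgeTheory.CMHodgeGroupIrreducibleBlocks
import Literature.AlgebraicGeometry.HodgeTheory.CMHodgeGroupCentreWeil
import Literature.AlgebraicGeometry.Motives.HodgeLieRigidModuloCentre
import HarnessLib

/-!
# A CM field `E = End_Hdg(V) = ℚ[φ]` acting with multiplicity `≥ 2` has a MIXED place: not every block `W_σ` is `Θ`-scalar
# (otherwise `Θ ∈ E ⊗ ℂ`, `Lie Hg ⊆ E` is abelian and the blocks would be reducible — Mumford's ∕ Deligne's CM criterion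
# against Moonen–Zarhin's irreducibility of the `E`-eigenspaces)

Family `hodge`, layer `Literature/AlgebraicGeometry/HodgeTheory` (cell `pub-hodgeav-hg6`, req-37 (A) Q2b, TABLE X ROW 11; eng-4 g8,
lead g3 2026-08-29T06:26:43Z (a): the member datum «both places mixed» of the row-11 census is a CONSEQUENCE of the other data).
UNCONDITIONAL; theorems only, no definition, no named fact, no `sorry`. HONEST FRAMING of that cell: HC / HC_AV / HC_CM / H2
NOT proved — linear algebra of polarized weight-one `ℚ`-Hodge structures.

* **`CMThetaKWeil.exists_mixed_place`** — `H` effective polarized of weight `1`, `E = End_Hdg(V) = ℚ[φ]` (`hE`), a CM type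
  `μ : ι → ℂ` with blocks of dimension `n₀ ≥ 2` spanning `V_ℂ` with their conjugates: SOME place `k` is mixed
  (`W_{μ k}` meets both `V^{1,0}` and `V^{0,1}`). PROOF: if every `W_{μ k}` is `Θ`-scalar, so is every `W_{μ̄ k}` (adapted dual
  basis, opposite Hodge types), hence every `X ∈ Lie Hg` commutes with `Θ` and is a Hodge endomorphism
  (`mem_endAlg_of_commute_theta`), hence acts on `W_{μ k}` by a scalar (`CMTheta.exists_smul_of_mem_endAlg`); then a line in
  `W_{μ k}` is `Lie Hg`-stable, contradicting the irreducibility `CMIrred.eigenspace_irreducible` for `n₀ ≥ 2`.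
* **`CMThetaKWeil.mixed_of_kBalance`** — two places with `p_{k₁} + p_{k₂} = n₀ = q_{k₁} + q_{k₂}`... stated as: `n₀ ≥ 2`,
  `ι = {k₁, k₂}`, `p_{k₁} + p_{k₂} = n₀` (the `K`-Weil signature along `μ`): BOTH places are mixed (arithmetic from the above).

## References
* [Deligne1982HodgeCycles] P. Deligne, LNM 900 (1982), I §3 Prop. 3.4 and Ex. 3.7 (CM ⟺ `MT` a torus), §4 (p. 30).
* [MoonenZarhin1999LowDim] B. Moonen, Yu. Zarhin, Math. Ann. 315 (1999), §2 (2.3), §3 proof of Lemma (3.4).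
* [MumfordShimuraNote1969] D. Mumford, Math. Ann. 181 (1969), §2.
-/

noncomputable section

open scoped TensorProduct
open Module

namespace Literature.AlgebraicGeometry.Motives

namespace HodgeStructure

universe u

variable {V : Type u} [AddCommGroup V] [Module ℚ V] {n : ℤ}

/-- `Fin 2 = {0, 1}`. [folklore] -/
private theorem CMThetaKWeil.fin2_cases''' (r : Fin 2) : r = 0 ∨ r = 1 := by
  rcases r with ⟨_ | _ | k, hk⟩
  · exact Or.inl rfl
  · exact Or.inr rfl
  · omega

/-- **A CM FIELD ACTING WITH MULTIPLICITY `≥ 2` HAS A MIXED PLACE** (see the module docstring).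
[cite: Deligne1982HodgeCycles, I §3 Prop. 3.4 and Ex. 3.7] [cite: MoonenZarhin1999LowDim, §3 proof of Lemma (3.4)] -/
theorem CMThetaKWeil.exists_mixed_place [Module.Finite ℚ V] [HodgeTensorFacts.{u, u}] {ι : Type} [Fintype ι] [DecidableEq ι]
    (H : HodgeStructure V n) (hn : n = 1) (heff : H.IsEffective) (ψ : H.Polarization)
    {φ : Module.End ℚ V} (hφE : φ ∈ H.endAlg) {m : ℕ} (hE : ∀ a ∈ H.endAlg, ∃ q : Fin m → ℚ, a = ∑ k, q k • φ ^ (k : ℕ))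
    (μ : ι → ℂ) (hinj : Function.Injective μ) (hdist : ∀ k k', μ k' ≠ starRingEnd ℂ (μ k)) {n₀ : ℕ} (hn₀ : 2 ≤ n₀)
    (hrank : ∀ k, Module.finrank ℂ ↥(Module.End.eigenspace (φ.baseChange ℂ) (μ k) ⊓ H.piece 1 0) +
      Module.finrank ℂ ↥(Module.End.eigenspace (φ.baseChange ℂ) (μ k) ⊓ H.piece 0 1) = n₀)
    (htop : (⨆ kt : ι × Fin 2, Module.End.eigenspace (φ.baseChange ℂ)
      (if kt.2 = 0 then μ kt.1 else starRingEnd ℂ (μ kt.1))) = ⊤) (k₀ : ι) :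
    ∃ k, Module.finrank ℂ ↥(Module.End.eigenspace (φ.baseChange ℂ) (μ k) ⊓ H.piece 1 0) ≠ 0 ∧
      Module.finrank ℂ ↥(Module.End.eigenspace (φ.baseChange ℂ) (μ k) ⊓ H.piece 0 1) ≠ 0 := by
  classical
  by_contra hall
  push Not at hall
  have hall' : ∀ k, Module.finrank ℂ ↥(Module.End.eigenspace (φ.baseChange ℂ) (μ k) ⊓ H.piece 1 0) = 0 ∨
      Module.finrank ℂ ↥(Module.End.eigenspace (φ.baseChange ℂ) (μ k) ⊓ H.piece 0 1) = 0 := fun k => by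
    by_cases h : Module.finrank ℂ ↥(Module.End.eigenspace (φ.baseChange ℂ) (μ k) ⊓ H.piece 1 0) = 0
    · exact Or.inl h
    · exact Or.inr (hall k h)
  set F := φ.baseChange ℂ with hF
  obtain ⟨Θ, hΘ⟩ := exists_hodgeTheta H
  obtain ⟨-, -, hΘ10, hΘ01, -⟩ := UnitaryTheta.theta_facts H hn heff hΘ
  -- `Θ` is a scalar `ε k` on every `W_{μ k}` …
  choose ε hε using fun k => CMNoTwist.theta_eq_smul_of_unbalanced H hn heff hφE hΘ (hall' k)
  -- … and `−ε k` on every `W_{μ̄ k}` (adapted dual basis: opposite Hodge types)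
  obtain ⟨cb, κ, hcbW, hcbW', hκ0, hκ1, -, -⟩ := CMTheta.exists_adaptedDualBasis H hn heff ψ hφE hE μ hinj hdist hrank htop
  have hfin : ∀ k, Module.finrank ℂ ↥(Module.End.eigenspace F (μ k)) = n₀ := fun k => by
    rw [hF, CMTheta.finrank_eigenspace_eq_add H hn heff hφE, hrank k]
  have hfin' : ∀ k, Module.finrank ℂ ↥(Module.End.eigenspace F (starRingEnd ℂ (μ k))) = n₀ := fun k => by
    rw [← hfin k, hF, ← finrank_eigenspace_baseChange_conj_eq starRingAut φ (μ k), starRingAut_apply, starRingEnd_apply]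
  subst hn
  have hΘcb1 : ∀ k ℓ, Θ (cb ((k, 1), ℓ)) = -(ε k • cb ((k, 1), ℓ)) := by
    intro k ℓ
    have h0 := hε k _ (hcbW k ℓ)
    have hne : cb ((k, 0), ℓ) ≠ 0 := cb.ne_zero _
    rcases CMThetaKWeil.fin2_cases''' (κ (k, ℓ)) with hκ | hκ
    · obtain ⟨h10, h01⟩ := hκ0 k ℓ hκ
      rw [hΘ10 _ h10] at h0
      have hε1 : ε k = 1 := by
        have h' : (ε k - 1) • cb ((k, 0), ℓ) = 0 := by rw [sub_smul, one_smul, ← h0, sub_self]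
        exact sub_eq_zero.1 ((smul_eq_zero.1 h').resolve_right hne)
      rw [hΘ01 _ h01, hε1, one_smul]
    · obtain ⟨h01, h10⟩ := hκ1 k ℓ hκ
      rw [hΘ01 _ h01] at h0
      have hε1 : ε k = -1 := by
        have h' : (ε k + 1) • cb ((k, 0), ℓ) = 0 := by rw [add_smul, one_smul, ← h0, neg_add_cancel]
        exact eq_neg_of_add_eq_zero_left ((smul_eq_zero.1 h').resolve_right hne)
      rw [hΘ10 _ h10, hε1, neg_smul, one_smul, neg_neg]
  have he1 : ∀ k : ι, Function.Injective (fun j : Fin n₀ => (((k, (1 : Fin 2)), j) : (ι × Fin 2) × Fin n₀)) :=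
    fun k j j' h => by simpa using h
  have hspan' : ∀ k, Module.End.eigenspace F (starRingEnd ℂ (μ k)) =
      Submodule.span ℂ (Set.range (cb ∘ fun j : Fin n₀ => ((k, (1 : Fin 2)), j))) := fun k =>
    CMArith.eq_span_of_basis cb _ (he1 k) _ (hcbW' k) (hfin' k)
  have hε' : ∀ k, ∀ w ∈ Module.End.eigenspace F (starRingEnd ℂ (μ k)), Θ w = -(ε k • w) := by
    intro k w hw
    rw [hspan' k] at hw
    obtain ⟨c, rfl⟩ := (Submodule.mem_span_range_iff_exists_fun ℂ).1 hw
    rw [map_sum, Finset.smul_sum, ← Finset.sum_neg_distrib]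
    exact Finset.sum_congr rfl fun j _ => by rw [map_smul, Function.comp_apply, hΘcb1, smul_neg, smul_comm]
  -- every `X ∈ Lie Hg` commutes with `Θ`, hence is a Hodge endomorphism
  have hXφ : ∀ X ∈ H.hodgeLie, X.baseChange ℂ * F = F * X.baseChange ℂ := fun X hX =>
    UnitaryTheta.baseChange_commute H hφE (fun X hX a => H.commute_of_mem_hodgeLie hX a) hX
  have hXW : ∀ X ∈ H.hodgeLie, ∀ c, ∀ w ∈ Module.End.eigenspace F c, X.baseChange ℂ w ∈ Module.End.eigenspace F c :=
    fun X hX c w hw => UnitaryTheta.apply_mem_eigenspace_of_commute (hXφ X hX) hw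
  have hcomm : ∀ X ∈ H.hodgeLie, X.baseChange ℂ * Θ = Θ * X.baseChange ℂ := by
    intro X hX
    refine LinearMap.ext fun v => ?_
    have hv : v ∈ ⨆ kt : ι × Fin 2, Module.End.eigenspace F (if kt.2 = 0 then μ kt.1 else starRingEnd ℂ (μ kt.1)) := by
      rw [htop]; exact Submodule.mem_top
    refine Submodule.iSup_induction _ hv (motive := fun v => (X.baseChange ℂ * Θ) v = (Θ * X.baseChange ℂ) v) ?_
      (by simp only [map_zero]) (fun x y hx hy => by simp only [map_add, hx, hy])
    rintro ⟨k, t⟩ w hw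
    rw [Module.End.mul_apply, Module.End.mul_apply]
    rcases CMThetaKWeil.fin2_cases''' t with rfl | rfl
    · rw [if_pos rfl] at hw
      rw [hε k w hw, map_smul, hε k _ (hXW X hX _ w hw)]
    · rw [if_neg one_ne_zero] at hw
      rw [hε' k w hw, map_neg, map_smul, hε' k _ (hXW X hX _ w hw)]
  have hXE : ∀ X ∈ H.hodgeLie, X ∈ H.endAlg := fun X hX => mem_endAlg_of_commute_theta H hΘ (hcomm X hX)
  -- so `Lie Hg` acts on `W_{μ k₀}` by scalars, and a line is stable: contradiction with irreducibility
  set v := cb ((k₀, 0), (⟨0, by omega⟩ : Fin n₀)) with hvdef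
  have hv0 : v ≠ 0 := cb.ne_zero _
  have hvW : v ∈ Module.End.eigenspace F (μ k₀) := hcbW k₀ _
  set L : Submodule ℂ (ℂ ⊗[ℚ] V) := ℂ ∙ v with hL
  have hLW : L ≤ Module.End.eigenspace F (μ k₀) := (Submodule.span_singleton_le_iff_mem _ _).2 hvW
  have hLst : ∀ X ∈ H.hodgeLie, ∀ u ∈ L, X.baseChange ℂ u ∈ L := by
    intro X hX u hu
    obtain ⟨s, hs⟩ := CMTheta.exists_smul_of_mem_endAlg H hE (hXE X hX) (μ k₀)
    obtain ⟨c, rfl⟩ := Submodule.mem_span_singleton.1 hu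
    rw [map_smul, hs v hvW, smul_smul]
    exact Submodule.smul_mem _ _ (Submodule.mem_span_singleton_self v)
  have hΘ𝔤 : Θ ∈ spanC H.hodgeLie := (hodgeLieC_eq_spanC H) ▸ H.mem_hodgeLieC_of_forall_piece hΘ
  rcases CMIrred.eigenspace_irreducible H rfl heff ψ hφE hE μ hinj hdist htop H.hodgeLie hΘ hΘ𝔤
      (fun X hX a => H.commute_of_mem_hodgeLie hX a) (fun X hX => form_apply_add_eq_zero_of_mem_hodgeLie ψ hX) k₀ L hLW hLst
    with hbot | htop'
  · exact hv0 ((Submodule.span_singleton_eq_bot).1 hbot)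
  · have h1 : Module.finrank ℂ ↥L = 1 := by rw [hL]; exact finrank_span_singleton hv0
    rw [htop', hfin k₀] at h1
    omega

/-- **`K`-WEIL BALANCE ⟹ BOTH PLACES MIXED.** Two places `k₁ ≠ k₂` covering `ι`, blocks of dimension `n₀ ≥ 2`, and
`p_{k₁} + p_{k₂} = n₀` (the `K`-signature `(n₀ |ι|/…)` — for `n₀ = 3`: `(3,3)` — along the CM type): then BOTH `W_{μ k₁}` and
`W_{μ k₂}` are mixed (some place is mixed by `CMThetaKWeil.exists_mixed_place`, and the balance transfers it to the other).
[cite: MoonenZarhin1999LowDim, §2 (2.3)] [cite: Deligne1982HodgeCycles, I §3 Ex. 3.7] -/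
theorem CMThetaKWeil.mixed_of_kBalance [Module.Finite ℚ V] [HodgeTensorFacts.{u, u}] {ι : Type} [Fintype ι] [DecidableEq ι]
    (H : HodgeStructure V n) (hn : n = 1) (heff : H.IsEffective) (ψ : H.Polarization)
    {φ : Module.End ℚ V} (hφE : φ ∈ H.endAlg) {m : ℕ} (hE : ∀ a ∈ H.endAlg, ∃ q : Fin m → ℚ, a = ∑ k, q k • φ ^ (k : ℕ))
    (μ : ι → ℂ) (hinj : Function.Injective μ) (hdist : ∀ k k', μ k' ≠ starRingEnd ℂ (μ k)) {n₀ : ℕ} (hn₀ : 2 ≤ n₀)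
    (hrank : ∀ k, Module.finrank ℂ ↥(Module.End.eigenspace (φ.baseChange ℂ) (μ k) ⊓ H.piece 1 0) +
      Module.finrank ℂ ↥(Module.End.eigenspace (φ.baseChange ℂ) (μ k) ⊓ H.piece 0 1) = n₀)
    (htop : (⨆ kt : ι × Fin 2, Module.End.eigenspace (φ.baseChange ℂ)
      (if kt.2 = 0 then μ kt.1 else starRingEnd ℂ (μ kt.1))) = ⊤)
    (k₁ k₂ : ι) (hι : ∀ k, k = k₁ ∨ k = k₂)
    (hKW : Module.finrank ℂ ↥(Module.End.eigenspace (φ.baseChange ℂ) (μ k₁) ⊓ H.piece 1 0) +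
      Module.finrank ℂ ↥(Module.End.eigenspace (φ.baseChange ℂ) (μ k₂) ⊓ H.piece 1 0) = n₀) (k : ι) :
    Module.finrank ℂ ↥(Module.End.eigenspace (φ.baseChange ℂ) (μ k) ⊓ H.piece 1 0) ≠ 0 ∧
      Module.finrank ℂ ↥(Module.End.eigenspace (φ.baseChange ℂ) (μ k) ⊓ H.piece 0 1) ≠ 0 := by
  obtain ⟨j, hj⟩ := CMThetaKWeil.exists_mixed_place H hn heff ψ hφE hE μ hinj hdist hn₀ hrank htop k₁
  have h1 := hrank k₁; have h2 := hrank k₂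
  rcases hι j with rfl | rfl <;> rcases hι k with rfl | rfl
  · exact hj
  · omega
  · omega
  · exact hj

end HodgeStructure

end Literature.AlgebraicGeometry.Motives

end
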